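import Literature.AlgebraicGeometry.HodgeTheory.PicardLefschetzNodalForms
import Literature.AlgebraicGeometry.HodgeTheory.VeryGeneralHypersurfaceHodgeConjecture
import Literature.AlgebraicGeometry.Motives.UniversalHypersurfaceTotalSpacePoints
import Literature.AlgebraicGeometry.Motives.AlgPointsProperProofs
import HarnessLib

/-!
# Homogeneous coordinates on the universal family of smooth hypersurfaces: `([z], π)` is a closed embedding of
# `𝒴_U(ℂ)`, and `Y_s(ℂ) ≃ₜ {[z] | F_s(z) = 0}`

Family `hodge`, layer `Literature/AlgebraicGeometry/HodgeTheory`; proof file (theorems only, no definition, no named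
fact). Written by the prover seat `hodge-nonav-prover-Bx` (g13, cell `hodge-nonav`) for crux K1-B
`VeryGeneralSignCommutatorsInHg` of the route `HodgeConjecture/SignSymmetricPowers` (stmt-HodgeConjecture-19716), binder
`picardLefschetz_nodalForms_uniform` (`HodgeTheory/PicardLefschetzNodalForms`): the TOPOLOGICAL half of the point-set
presentation `𝒴_U(ℂ) = {([z], s) | F_s(z) = 0}` of `Motives/UniversalHypersurfaceTotalSpacePoints` (prover-Ax), i.e. the
universal-family twin of `CyclicCoverTotalSpacePoints` §3 and `CyclicCoverPencilFibreEmbedding` (the Carlson–Toledo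
family). It is what one needs to write down continuous fibrewise isotopies of `π = family ℂ n d : 𝒴_U → U` in
coordinates (sequel `UniversalHypersurfaceTransportOfIsotopy`: a projective isotopy of the zero sets over a loop computes
the rational transport).

* §1 `isProperMap_map_family`, **`isClosedEmbedding_coords_prod_map_family`** — `([z], π) : 𝒴_U(ℂ) → ℙ(ℂⁿ⁺²) × U(ℂ)`
  is a closed topological embedding (proper `π(ℂ)`, closed graph), so a map into `𝒴_U(ℂ)` is continuous iff its
  coordinates and its base point are (`continuous_iff_coords_prod_map_family`).
* §2 the fibres: `fibrePoint n d s : Y_s(ℂ) → ℙ(ℂⁿ⁺²)` (`HodgeTheory/PicardLefschetzNodalForms`) is a topological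
  embedding of a compact Hausdorff space with range exactly `{[z] | F_s(z) = 0}` (`range_fibrePoint`,
  `exists_homeomorph_fibrePoint`).

## References

* [VoisinHodgeII2003] C. Voisin, Hodge Theory and Complex Algebraic Geometry II, CUP 2003, §6.2.1 (the universal
  hypersurface `{(x, F) | F(x) = 0}`).
* [SerreGAGA1956] J.-P. Serre, Géométrie algébrique et géométrie analytique, Ann. Inst. Fourier 6 (1956), §2 n°5
  Lemme 1 b) (closed immersions), n°7 Prop. 6 (compactness).
-/

noncomputable section

open CategoryTheory AlgebraicGeometry
open _root_.Topology
open scoped unitInterval LinearAlgebra.Projectivization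
open Literature.AlgebraicTopology.SingularHomology
open Literature.AlgebraicGeometry.Motives Literature.AlgebraicGeometry.Motives.UniversalHypersurface
open Literature.AlgebraicGeometry.HodgeTheory.UniversalHypersurface

namespace Literature.AlgebraicGeometry.HodgeTheory

section HodgeTheory

/-! ### §1 The total space in homogeneous coordinates: `([z], π)` is a closed embedding -/

section Total

variable (n d : ℕ)

/-- `π(ℂ) : 𝒴_U(ℂ) → U(ℂ)` is a proper map (`π` is proper; `n, d ≥ 1`). [cite: SerreGAGA1956, §2 n°7 Prop. 6] -/
theorem isProperMap_map_family (hn : 1 ≤ n) (hd : 1 ≤ d) :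
    IsProperMap (AlgPoints.map (family ℂ n d) : ComplexPoints (total ℂ n d) → ComplexPoints (base ℂ n d)) := by
  haveI : IsProper (family ℂ n d).left := (isSmoothProjectiveFamily_family ℂ hn hd).isProper
  haveI : UniversallyClosed (family ℂ n d).left := IsProper.toUniversallyClosed
  exact AlgPoints.isProperMap_map (family ℂ n d)

/-- **`([z], π) : 𝒴_U(ℂ) → ℙ(ℂⁿ⁺²) × U(ℂ)` is a closed topological embedding** (`n, d ≥ 1`): continuous, injective
(`eq_of_hypersurfacePoint_eq_of_map_family_eq`) and closed (it is the closed graph embedding of `[z]` followed by the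
proper map `id × π(ℂ)`). Hence `𝒴_U(ℂ)` is homeomorphic to the incidence set `{([z], s) | F_s(z) = 0}`.
[cite: VoisinHodgeII2003, §6.2.1] [cite: SerreGAGA1956, §2 n°5 Lemme 1 b)] -/
theorem isClosedEmbedding_coords_prod_map_family (hn : 1 ≤ n) (hd : 1 ≤ d) :
    IsClosedEmbedding fun P : ComplexPoints (total ℂ n d) =>
      (hypersurfacePoint (toProjectiveSpace ℂ n d) P, AlgPoints.map (family ℂ n d) P) := by
  haveI : T2Space (ℙ ℂ (Fin (n + 2) → ℂ)) := Projectivization.t2Space_pi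
  have hc := continuous_hypersurfacePoint (toProjectiveSpace ℂ n d)
  have hπ := AlgPoints.continuous_map (L := ℂ) (family ℂ n d)
  refine IsClosedEmbedding.of_continuous_injective_isClosedMap (hc.prodMk hπ)
    (fun P P' h => eq_of_hypersurfacePoint_eq_of_map_family_eq n d hd (congrArg Prod.fst h)
      (congrArg Prod.snd h)) ?_
  intro C hC
  -- the graph embedding `P ↦ ([z](P), P)` is closed
  have hce : IsClosedEmbedding fun P : ComplexPoints (total ℂ n d) =>
      (hypersurfacePoint (toProjectiveSpace ℂ n d) P, P) :=
    IsClosedEmbedding.of_continuous_injective_isClosedMap (hc.prodMk continuous_id)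
      (fun P P' h => congrArg Prod.snd h) (by
        intro D hD
        have : (fun P : ComplexPoints (total ℂ n d) => (hypersurfacePoint (toProjectiveSpace ℂ n d) P, P)) '' D =
            {x | x.1 = hypersurfacePoint (toProjectiveSpace ℂ n d) x.2} ∩ Prod.snd ⁻¹' D := by
          ext x
          obtain ⟨a, b⟩ := x
          constructor
          · rintro ⟨P, hP, h⟩
            rw [Prod.mk.injEq] at h
            obtain ⟨rfl, rfl⟩ := h
            exact ⟨rfl, hP⟩
          · rintro ⟨h1, h2⟩
            exact ⟨b, h2, Prod.ext h1.symm rfl⟩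
        rw [this]
        exact (isClosed_eq continuous_fst (hc.comp continuous_snd)).inter (hD.preimage continuous_snd))
  have hprop : IsProperMap (Prod.map (id : ℙ ℂ (Fin (n + 2) → ℂ) → ℙ ℂ (Fin (n + 2) → ℂ))
      (AlgPoints.map (family ℂ n d) : ComplexPoints (total ℂ n d) → ComplexPoints (base ℂ n d))) :=
    isProperMap_id.prodMap (isProperMap_map_family n d hn hd)
  have heq : (fun P : ComplexPoints (total ℂ n d) =>
      (hypersurfacePoint (toProjectiveSpace ℂ n d) P, AlgPoints.map (family ℂ n d) P)) '' C =
      Prod.map id (AlgPoints.map (family ℂ n d)) ''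
        ((fun P : ComplexPoints (total ℂ n d) => (hypersurfacePoint (toProjectiveSpace ℂ n d) P, P)) '' C) := by
    rw [Set.image_image]
    rfl
  rw [heq]
  exact hprop.isClosedMap _ (hce.isClosedMap C hC)

/-- **Continuity into `𝒴_U(ℂ)` is continuity of the coordinates and of the base point** (`n, d ≥ 1`).
[cite: SerreGAGA1956, §2 n°5 Lemme 1 b)] -/
theorem continuous_iff_coords_prod_map_family (hn : 1 ≤ n) (hd : 1 ≤ d) {A : Type*} [TopologicalSpace A]
    (f : A → ComplexPoints (total ℂ n d)) :
    Continuous f ↔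
      Continuous (fun a => hypersurfacePoint (toProjectiveSpace ℂ n d) (f a)) ∧
        Continuous (fun a => AlgPoints.map (family ℂ n d) (f a)) := by
  rw [(isClosedEmbedding_coords_prod_map_family n d hn hd).isEmbedding.isInducing.continuous_iff]
  change Continuous (fun a => (hypersurfacePoint (toProjectiveSpace ℂ n d) (f a), AlgPoints.map (family ℂ n d) (f a))) ↔ _
  constructor
  · intro h
    exact ⟨continuous_fst.comp h, continuous_snd.comp h⟩
  · rintro ⟨h1, h2⟩
    exact h1.prodMk h2

end Total

/-! ### §2 The fibres in homogeneous coordinates -/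

section Fibre

variable {n d : ℕ}

/-- The coordinates of a point of `Y_s(ℂ)` are those of its image in `𝒴_U(ℂ)` (functoriality of `hypersurfacePoint`).
[cite: VoisinHodgeII2003, §6.2.1] -/
theorem fibrePoint_eq_hypersurfacePoint_map_fiberι (s : ComplexPoints (base ℂ n d))
    (y : ComplexPoints (fiberOver (family ℂ n d) s)) :
    fibrePoint n d s y =
      hypersurfacePoint (toProjectiveSpace ℂ n d) (AlgPoints.map (fiberι (family ℂ n d) s) y) := by
  rw [fibrePoint_def, hypersurfacePoint_comp]

/-- `fibrePoint n d s` is continuous (`Y_s(ℂ) → ℙⁿ⁺¹(ℂ)` is induced by a morphism). [cite: SerreGAGA1956, §2 n°5] -/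
theorem continuous_fibrePoint (s : ComplexPoints (base ℂ n d)) : Continuous (fibrePoint n d s) :=
  continuous_hypersurfacePoint _

/-- Every point of `Y_s(ℂ)` has coordinates on the hypersurface `{F_s = 0}` (`d ≥ 1`). [cite: VoisinHodgeII2003, §6.2.1] -/
theorem fibrePoint_mem_projZeroLocus (hd : 1 ≤ d) (s : ComplexPoints (base ℂ n d))
    (y : ComplexPoints (fiberOver (family ℂ n d) s)) :
    fibrePoint n d s y ∈ Projectivization.projZeroLocus {pointForm ℂ n d s} := by
  rw [fibrePoint_eq_hypersurfacePoint_map_fiberι]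
  have h := hypersurfacePoint_mem_projZeroLocus_pointForm n d hd (AlgPoints.map (fiberι (family ℂ n d) s) y)
  rwa [AlgPoints.map_map_fiberι] at h

/-- `fibrePoint n d s : Y_s(ℂ) → ℙ(ℂⁿ⁺²)` is a topological embedding (`Y_s ↪ ℙⁿ⁺¹` is a closed immersion).
[cite: SerreGAGA1956, §2 n°5 Lemme 1 b)] -/
theorem isEmbedding_fibrePoint (s : ComplexPoints (base ℂ n d)) : IsEmbedding (fibrePoint n d s) := by
  haveI := UniversalHypersurface.isClosedImmersion_fiberι_toProjectiveSpace_left ℂ n d s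
  exact isEmbedding_hypersurfacePoint _

/-- `fibrePoint n d s` is injective. [cite: SerreGAGA1956, §2 n°5 Lemme 1 b)] -/
theorem fibrePoint_injective (s : ComplexPoints (base ℂ n d)) : Function.Injective (fibrePoint n d s) :=
  (isEmbedding_fibrePoint s).injective

/-- **The range of `fibrePoint n d s` is exactly `{[z] | F_s(z) = 0}`** (`d ≥ 1`). [cite: VoisinHodgeII2003, §6.2.1] -/
theorem range_fibrePoint (hd : 1 ≤ d) (s : ComplexPoints (base ℂ n d)) :
    Set.range (fibrePoint n d s) = Projectivization.projZeroLocus {pointForm ℂ n d s} := by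
  refine Set.Subset.antisymm ?_ ?_
  · rintro _ ⟨y, rfl⟩
    exact fibrePoint_mem_projZeroLocus hd s y
  · intro ℓ hℓ
    obtain ⟨P, hP, hPℓ⟩ := exists_point_of_mem_projZeroLocus_pointForm n d hd s hℓ
    obtain ⟨y, rfl⟩ : P ∈ Set.range (AlgPoints.map (fiberι (family ℂ n d) s)) := by
      rw [AlgPoints.range_map_fiberι]; exact hP
    exact ⟨y, by rw [fibrePoint_eq_hypersurfacePoint_map_fiberι]; exact hPℓ⟩

/-- `Y_s(ℂ)` is compact (`π` proper; `n, d ≥ 1`). [cite: SerreGAGA1956, §2 n°7 Prop. 6] -/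
theorem compactSpace_fibre_family (hn : 1 ≤ n) (hd : 1 ≤ d) (s : ComplexPoints (base ℂ n d)) :
    CompactSpace (ComplexPoints (fiberOver (family ℂ n d) s)) := by
  haveI : IsProper (family ℂ n d).left := (isSmoothProjectiveFamily_family ℂ hn hd).isProper
  haveI : IsProper (fiberOver (family ℂ n d) s).hom := isProper_fiberOver_hom (family ℂ n d) s
  exact compactSpace_algPoints_of_isProper_holds _ ℂ

/-- `Y_s(ℂ)` is Hausdorff (it embeds in `ℙ(ℂⁿ⁺²)`). [cite: SerreGAGA1956, §2 n°5] -/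
theorem t2Space_fibre_family (s : ComplexPoints (base ℂ n d)) :
    T2Space (ComplexPoints (fiberOver (family ℂ n d) s)) := by
  haveI : T2Space (ℙ ℂ (Fin (n + 2) → ℂ)) := Projectivization.t2Space_pi
  exact (isEmbedding_fibrePoint s).t2Space

/-- **`Y_s(ℂ) ≃ₜ {[z] | F_s(z) = 0}`** by `fibrePoint n d s` (`d ≥ 1`). [cite: VoisinHodgeII2003, §6.2.1]
[cite: SerreGAGA1956, §2 n°5 Lemme 1 b)] -/
theorem exists_homeomorph_fibrePoint (hd : 1 ≤ d) (s : ComplexPoints (base ℂ n d)) :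
    ∃ e : ComplexPoints (fiberOver (family ℂ n d) s) ≃ₜ
        {ℓ // ℓ ∈ Projectivization.projZeroLocus {pointForm ℂ n d s}},
      ∀ y, (e y).1 = fibrePoint n d s y :=
  ⟨(isEmbedding_fibrePoint s).toHomeomorph.trans (Homeomorph.setCongr (range_fibrePoint hd s)), fun _ => rfl⟩

end Fibre

end HodgeTheory

end Literature.AlgebraicGeometry.HodgeTheory

end
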